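import Literature.Computability.AlgebraicComplexity.KV20Cor13Assembly
import Literature.Computability.AlgebraicComplexity.KV20CertificateRelation
import Literature.Computability.AlgebraicComplexity.KV20CanonicalEquation
import HarnessLib

/-!
# Kumar–Volk, Cor. 1.3 from polynomial-space equations (the roster's closer; + the ONE-LINE form via the canonical family)

Topic `Literature/Computability/AlgebraicComplexity`; closer of the val-lit roster "KV20 Cor 1.3
REDUCTION" (lead-np RULINGS (105)/(106), 2026-08-27; owner x5): the typed fact
`kumarVolk2020_cor_1_3` (`KV20EquationsPITWinWin.lean`; M. Kumar, B. L. Volk, ACM TOCT 14(2)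
(2022) art. 6 = arXiv:2003.12938 [KumarVolk2022], Cor. 1.3, §6) FROM THE SINGLE REMAINING
HYPOTHESIS (M1) — the printed "fixed PSPACE algorithm which, on input `1^n`, outputs the list of
coefficients of `Q_n`" (arXiv p0009:L1–3), spelled inline as `hM1` — by instantiating the
assembly `KumarVolk2020.cor_1_3_of_kit` (`KV20Cor13Assembly.lean`, x5) with the certificate kit of
`KV20CertificateRelation.lean` (p1: `certRel ∈ P` under `PIT ∈ P`, the output writer `ptList ∈ FP`,
soundness and completeness of the certificate "`C ∘ Ũ_n ≡ 0` and `C(a) ≢ 0`", both identity tests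
being `PITLanguage` instances written by `KV20UniversalMapWriter.lean` / x5 g5's `evalCircuit`).

So `kumarVolk2020_cor_1_3_holds` will be `kumarVolk2020_cor_1_3_of_pspaceEquations ⟨Q, …⟩` once
(M1) — a uniform polynomial-space transducer with exponentially long output solving the succinct
linear system `Q ∘ Ũ_n = 0` (`KumarVolk2020.bind₁_eq_zero_iff_linearSystem`) — is formalised
(programme of record HOME/np/MEMO-x5g6-KV20-M1-programme.md; NOT done here, UNSTAFFED). STATUS IN
ONE SENTENCE: `kumarVolk2020_cor_1_3` stays OPEN by name — what remains is exactly (M1), i.e.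
generic succinct linear algebra in polynomial space (a nonzero kernel vector of an
exponential-dimensional integer system whose entries are polynomial-time computable integer
evaluations of `Ũ_n`, `KumarVolk2020.bind₁_uFin_eq_zero_iff_evalSystem`; the vector to output
is `Literature.LinearAlgebra.charpolyKernelVector (AᵀA)`, `charpolyKernelVector_gram_spec` — what
is missing is only the polynomial-space TRANSDUCER computing its bits); the hypothesis `hM1`
below is that statement verbatim and is NOT weakened, and the algebraic (non-uniform) part of
(M1) is already a theorem of the tree (`KumarVolk2020.exists_equations_nonuniform`).

DEVIATION FROM PRINT (RULING (105)(c)(i)): the non-root point is part of the NP certificate, so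
KV's Def. 13 / Lemma 14 (almost-MD circuits, [MP08]) and Lemma 15 (deterministic non-root search)
are not formalised (arXiv p0008:L13–34); `δ = 1/200` as printed. Honest framing (val-lit): a
published CONDITIONAL result ("PIT ∈ P ⇒ one of two lower bounds") reduced to its uniformity
claim; census +0; nothing here bears on `VP ≠ VNP`, which is NOT proved.

## References

* [KumarVolk2022] M. Kumar, B. L. Volk, ACM TOCT 14(2) (2022) art. 6 = arXiv:2003.12938, Cor. 1.3, §6.
-/

namespace Literature.Computability.AlgebraicComplexity

open Literature.Computability.Complexity _root_.Computability MvPolynomial KumarVolk2020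

/-- **Kumar–Volk Cor. 1.3 from PSPACE-uniform equations.** If some family `Q : ∀ m, ℤ[x_1..x_m]`
of p-bounded degree has its coefficient bit language in `PSPACE` and `Q (n·n)` is, for all large
`n`, a nonzero equation of the integer universal map `Ũ_n` (`bind₁ (uFin n) (Q (n*n)) = 0`) — the
printed "fixed PSPACE algorithm … outputs the list of coefficients of `Q_n`" — then
`kumarVolk2020_cor_1_3` holds: `cor_1_3_of_kit` with the certificate kit `certRel` / `ptList`.
[cite: KumarVolk2022, Cor. 1.3 (proof, §6)] -/
theorem kumarVolk2020_cor_1_3_of_pspaceEquations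
    (hM1 : ∃ Q : ∀ m, MvPolynomial (Fin m) ℤ,
      coeffBitLanguage Q ∈ PSPACE ∧ IsPBounded (fun m => (Q m).totalDegree) ∧
        ∃ n₀ : ℕ, ∀ n, n₀ ≤ n → Q (n * n) ≠ 0 ∧ bind₁ (uFin n) (Q (n * n)) = 0) :
    kumarVolk2020_cor_1_3 :=
  cor_1_3_of_kit Cor13Cert.certRel Cor13Cert.ptList Cor13Cert.certRel_mem_P Cor13Cert.ptList_mem_FP
    Cor13Cert.certRel_sound Cor13Cert.certRel_complete hM1

/-- The two spellings of the re-indexed universal map agree definitionally: the assembly's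
`uFin n` (`corSize n = n²/200`) is the certificate file's
`fun q => universalMapInt n (corS n) (finProdFinEquiv.symm q)` (`corS n = n²/200`).
[cite: KumarVolk2022, §6 (proof of Cor. 1.3, "size less than n²/200")] -/
theorem KumarVolk2020.uFin_eq_corS (n : ℕ) :
    uFin n = fun q : Fin (n * n) => universalMapInt n (Cor13Cert.corS n) (finProdFinEquiv.symm q) :=
  rfl

/-- **(M1) in the certificate file's spelling** ⟹ Cor. 1.3 (same theorem, `corS` for `corSize`).
[cite: KumarVolk2022, Cor. 1.3 (proof, §6)] -/
theorem kumarVolk2020_cor_1_3_of_pspaceEquations'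
    (hM1 : ∃ Q : ∀ m, MvPolynomial (Fin m) ℤ,
      coeffBitLanguage Q ∈ PSPACE ∧ IsPBounded (fun m => (Q m).totalDegree) ∧
        ∃ n₀ : ℕ, ∀ n, n₀ ≤ n → Q (n * n) ≠ 0 ∧
          bind₁ (fun q : Fin (n * n) => universalMapInt n (Cor13Cert.corS n) (finProdFinEquiv.symm q))
            (Q (n * n)) = 0) :
    kumarVolk2020_cor_1_3 :=
  kumarVolk2020_cor_1_3_of_pspaceEquations hM1

/-- ★ **Kumar–Volk Cor. 1.3 from ONE membership statement**: if the coefficient-bit language of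
the EXPLICIT canonical family `KumarVolk2020.kvCanonicalFamily` (`KV20CanonicalEquation.lean`:
`Q_n` = the polynomial whose coefficient vector is the canonical kernel vector of the Gram matrix
of the evaluation system of `Ũ_n`) is in `PSPACE`, then `kumarVolk2020_cor_1_3` holds. This is
the M1 target of record with no existential left: `kumarVolk2020_cor_1_3_holds` will be this
theorem applied to the transducer's correctness theorem.
[cite: KumarVolk2022, Cor. 1.3 (proof, §6: "a fixed PSPACE algorithm which, on input 1ⁿ, outputs the list of coefficients of the polynomial Q_n")] -/
theorem kumarVolk2020_cor_1_3_of_canonicalBits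
    (hbits : coeffBitLanguage KumarVolk2020.kvCanonicalFamily ∈ PSPACE) : kumarVolk2020_cor_1_3 :=
  cor_1_3_of_canonicalBits Cor13Cert.certRel Cor13Cert.ptList Cor13Cert.certRel_mem_P
    Cor13Cert.ptList_mem_FP Cor13Cert.certRel_sound Cor13Cert.certRel_complete hbits

/-- The scaled variant: bits of any nonzero-constant multiple `m ↦ c m • Q_{√m}` in `PSPACE`
suffice (a transducer may clear denominators). [cite: KumarVolk2022, Cor. 1.3 (proof, §6)] -/
theorem kumarVolk2020_cor_1_3_of_scaledCanonicalBits (c : ℕ → ℤ) (hc : ∀ m, c m ≠ 0)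
    (hbits : coeffBitLanguage (fun m => c m • KumarVolk2020.kvCanonicalFamily m) ∈ PSPACE) :
    kumarVolk2020_cor_1_3 :=
  cor_1_3_of_scaledCanonicalBits Cor13Cert.certRel Cor13Cert.ptList Cor13Cert.certRel_mem_P
    Cor13Cert.ptList_mem_FP Cor13Cert.certRel_sound Cor13Cert.certRel_complete c hc hbits

end Literature.Computability.AlgebraicComplexity
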